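import Literature.Probability.Percolation.MarkedLoopHolomorphicDefect
import Literature.Probability.Percolation.MarkedLoopRotation
import HarnessLib

/-!
# The twenty-one picture classes of seven disorders and their class defects («SEVEN-CLASSES»)

Topic `Literature/Probability/Percolation`; generic-`k` layer of the three-disorder lineage (Khristoforov–Smirnov 2021) at `k = 7`, a sequel of
`MarkedLoopHolomorphicDefect.lean` (`tripodDefect`, `defectAt`, `tripodDefect_rotate`) and `MarkedLoopRotation.lean` (`rot`, `rotW`, `relMap`,
`holomorphicW_rotate_iff`). The k = 7 analogue of `§ Five` of `MarkedLoopNecessityFive.lean`, domain-free: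

* `§ Classes` — the three ROTATION ORBITS of tripod pictures on seven corners: the consecutive triple `{a, a+1, a+2}` with the other four corners
  matched ADJACENTLY (`adjRel a = {a+3 ~ a+4, a+5 ~ a+6}`) or NESTEDLY (`nestRel a = {a+3 ~ a+6, a+4 ~ a+5}`), and the triple `{a, a+1, a+4}` with its
  forced matching (`midRel a = {a+2 ~ a+3, a+5 ~ a+6}`); the 63 READINGS `reading a r` (`r : Fin 9`: class `r / 3`, cyclic reading `r % 3`) and their
  finset `pics7` (`card_pics7 = 63`); ★ every listed reading IS a tripod picture (`tripodPicture_adj/nest/mid/reading`, `tripodPicture_of_mem_pics7`).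
  (The converse — every tripod picture of seven corners is listed — needs the relation census of `MarkedLoopTripodBasisSeven.lean` and is
  `MarkedLoopPicturesSeven.lean`.)
* `§ Defects` — the CLASS DEFECTS `defA wt a`, `defN wt a`, `defM wt a` (the tripod defects of the three representatives read from the corner `a`);
  the tripod law kills them (`classDefects_eq_zero_of_tripodLaw`); the defect of every reading is a power of `τ` times its class defect
  (`defectAt_reading_*`); `tau_sq_eq₇`, `tau_im_ne_zero₇`.
* `§ Transport` — back-rotating the marks shifts the class index (`defA/defN/defM_rotW_symm`, `…_iterate`), and «holomorphic on every
  seven-marked domain» is stable under the rotations (`forall_holomorphicW_iterate₇`) — the bookkeeping that turns ONE face relation into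
  SEVEN (apply it to the rotated domains).

## References
* M. Khristoforov, S. Smirnov, *Percolation and O(1) loop model*, arXiv:2111.15612 (2021), §1.2 (arXiv v1 p. 2: link patterns, cyclic indexing of
  the marked points), §2 Definition 3 and Lemma 4 with its proof and Fig. 3 (p. 4), eq. (3) (p. 4).
* B. Bollobás, O. Riordan, *Percolation*, Cambridge University Press (2006), Ch. 7 §7.2.3 p. 197 (re-marking by relabelling).

## Mathlib / tree
Tree: `MarkedLoopHolomorphy.lean` (`TripodPicture`, `TripodPicture.rotate`, `TripodLaw`, `CcwTriple`, `CcwQuad`, `withPair`, `HolomorphicW`),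
`MarkedLoopHolomorphicDefect.lean` (`tripodDefect`, `defectAt`, `tripodDefect_rotate`, `tripodLaw_iff_tripodDefect`), `MarkedLoopRotation.lean` (`rot`, `rotW`,
`relMap`, `relMap_withPair`, `holomorphicW_rotate_iff`), `TriMarkedDomainRotate.lean` (`TriMarkedDomain.rotate`). Mathlib: `finRotate_symm_apply`,
`Function.iterate_succ_apply'`, `Fin.cast_val_eq_self`, `decide`.
-/

open Finset

namespace Literature.Probability.Percolation.MarkedLoops

open Literature.Probability.Percolation Literature.Probability.LatticeModels
open Literature.Probability.Percolation.FivePoint (tau)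
open TriMarkedDomain

/-! ### The three orbits of picture classes -/
section Classes

/-- the ADJACENT matching of the four corners opposite the consecutive triple `{a, a+1, a+2}`: `{a+3 ~ a+4, a+5 ~ a+6}`.
[cite: KhristoforovSmirnov2021, §1.2 (arXiv v1 p. 2: the link pattern)] -/
def adjRel (a : Fin 7) : Finset (Fin 7 × Fin 7) := {(a+3, a+4), (a+4, a+3), (a+5, a+6), (a+6, a+5)}

/-- the NESTED matching `{a+3 ~ a+6, a+4 ~ a+5}`. [cite: KhristoforovSmirnov2021, §1.2 (arXiv v1 p. 2)] -/
def nestRel (a : Fin 7) : Finset (Fin 7 × Fin 7) := {(a+3, a+6), (a+6, a+3), (a+4, a+5), (a+5, a+4)}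

/-- the FORCED matching opposite the triple `{a, a+1, a+4}`: `{a+2 ~ a+3, a+5 ~ a+6}`. [cite: KhristoforovSmirnov2021, §1.2 (arXiv v1 p. 2)] -/
def midRel (a : Fin 7) : Finset (Fin 7 × Fin 7) := {(a+2, a+3), (a+3, a+2), (a+5, a+6), (a+6, a+5)}

/-- the nine readings with distinguished corner `a`: `r / 3` = class (adjacent, nested, mid), `r % 3` = cyclic reading.
[cite: KhristoforovSmirnov2021, §2 Lemma 4, Fig. 3 (arXiv v1 p. 4)] -/
def reading (a : Fin 7) : Fin 9 → Fin 7 × Fin 7 × Fin 7 × Finset (Fin 7 × Fin 7)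
  | 0 => (a, a+1, a+2, adjRel a)
  | 1 => (a+1, a+2, a, adjRel a)
  | 2 => (a+2, a, a+1, adjRel a)
  | 3 => (a, a+1, a+2, nestRel a)
  | 4 => (a+1, a+2, a, nestRel a)
  | 5 => (a+2, a, a+1, nestRel a)
  | 6 => (a, a+1, a+4, midRel a)
  | 7 => (a+1, a+4, a, midRel a)
  | 8 => (a+4, a, a+1, midRel a)

/-- **the 63 readings of the 21 picture classes of seven disorders.** [cite: KhristoforovSmirnov2021, §2 Lemma 4, Fig. 3 (arXiv v1 p. 4)] -/
def pics7 : Finset (Fin 7 × Fin 7 × Fin 7 × Finset (Fin 7 × Fin 7)) := Finset.univ.image fun p : Fin 7 × Fin 9 => reading p.1 p.2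

/-- membership in the list. [cite: KhristoforovSmirnov2021, §2 Lemma 4, Fig. 3 (arXiv v1 p. 4)] -/
theorem mem_pics7 {P : Fin 7 × Fin 7 × Fin 7 × Finset (Fin 7 × Fin 7)} : P ∈ pics7 ↔ ∃ a r, reading a r = P := by
  simp only [pics7, Finset.mem_image, Finset.mem_univ, true_and, Prod.exists]

/-- there are `63 = 3 · 7 · 3` readings (no two coincide). [cite: KhristoforovSmirnov2021, §2 Lemma 4, Fig. 3 (arXiv v1 p. 4)] -/
theorem card_pics7 : pics7.card = 63 := by
  unfold pics7 reading adjRel nestRel midRel; decide +kernel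

/-- `CcwTriple` is decidable (by its defining formula; lets `decide` treat it as an atom). [folklore] -/
instance decCcwTriple {nm : ℕ} (a b c : Fin nm) : Decidable (CcwTriple a b c) :=
  inferInstanceAs (Decidable ((a < b ∧ b < c) ∨ (b < c ∧ c < a) ∨ (c < a ∧ a < b)))

/-- `CcwQuad` is decidable (by its defining formula). [folklore] -/
instance decCcwQuad {nm : ℕ} (a b c d : Fin nm) : Decidable (CcwQuad a b c d) :=
  inferInstanceAs (Decidable ((a < b ∧ b < c ∧ c < d) ∨ (b < c ∧ c < d ∧ d < a) ∨ (c < d ∧ d < a ∧ a < b) ∨ (d < a ∧ a < b ∧ b < c)))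

/-- the six defining conditions of a tripod picture, decided uniformly for a one-parameter family of readings. [folklore] -/
private theorem tripodPicture_family (f g : Fin 7 → Fin 7) (R : Fin 7 → Finset (Fin 7 × Fin 7))
    (hc : ∀ a, CcwTriple a (f a) (g a)) (hs : ∀ a x y, (x, y) ∈ R a → (y, x) ∈ R a) (hi : ∀ a x, (x, x) ∉ R a)
    (ho : ∀ a x y, (x, y) ∈ R a → x ≠ a ∧ x ≠ f a ∧ x ≠ g a)
    (hp : ∀ a x, x ≠ a → x ≠ f a → x ≠ g a → ∃ y, (x, y) ∈ R a ∧ ∀ y', (x, y') ∈ R a → y' = y)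
    (hq : ∀ a x y z w, (x, z) ∈ withPair (withPair (withPair (R a) a (f a)) (f a) (g a)) (g a) a → (y, w) ∈ R a → ¬ CcwQuad x y z w)
    (a : Fin 7) : TripodPicture a (f a) (g a) (R a) :=
  ⟨hc a, hs a, hi a, ho a, fun x h₁ h₂ h₃ => by obtain ⟨y, hy, hu⟩ := hp a x h₁ h₂ h₃; exact ⟨y, hy, hu⟩, hq a⟩

/-- ★ the listed readings ARE tripod pictures: adjacency class. [cite: KhristoforovSmirnov2021, §2 Lemma 4, Fig. 3 (arXiv v1 p. 4)] -/
theorem tripodPicture_adj (a : Fin 7) : TripodPicture a (a+1) (a+2) (adjRel a) := by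
  refine tripodPicture_family (· + 1) (· + 2) adjRel ?_ ?_ ?_ ?_ ?_ ?_ a
  · decide
  · unfold adjRel; decide +kernel
  · unfold adjRel; decide +kernel
  · unfold adjRel; decide +kernel
  · unfold adjRel; decide +kernel
  · unfold adjRel withPair; decide +kernel

/-- ★ nesting class. [cite: KhristoforovSmirnov2021, §2 Lemma 4, Fig. 3 (arXiv v1 p. 4)] -/
theorem tripodPicture_nest (a : Fin 7) : TripodPicture a (a+1) (a+2) (nestRel a) := by
  refine tripodPicture_family (· + 1) (· + 2) nestRel ?_ ?_ ?_ ?_ ?_ ?_ a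
  · decide
  · unfold nestRel; decide +kernel
  · unfold nestRel; decide +kernel
  · unfold nestRel; decide +kernel
  · unfold nestRel; decide +kernel
  · unfold nestRel withPair; decide +kernel

/-- ★ mid class. [cite: KhristoforovSmirnov2021, §2 Lemma 4, Fig. 3 (arXiv v1 p. 4)] -/
theorem tripodPicture_mid (a : Fin 7) : TripodPicture a (a+1) (a+4) (midRel a) := by
  refine tripodPicture_family (· + 1) (· + 4) midRel ?_ ?_ ?_ ?_ ?_ ?_ a
  · decide
  · unfold midRel; decide +kernel
  · unfold midRel; decide +kernel
  · unfold midRel; decide +kernel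
  · unfold midRel; decide +kernel
  · unfold midRel withPair; decide +kernel

/-- every listed reading is a tripod picture. [cite: KhristoforovSmirnov2021, §2 Lemma 4, Fig. 3 (arXiv v1 p. 4)] -/
theorem tripodPicture_reading (a : Fin 7) (r : Fin 9) :
    TripodPicture (reading a r).1 (reading a r).2.1 (reading a r).2.2.1 (reading a r).2.2.2 := by
  fin_cases r
  · exact tripodPicture_adj a
  · exact (tripodPicture_adj a).rotate
  · exact (tripodPicture_adj a).rotate.rotate
  · exact tripodPicture_nest a
  · exact (tripodPicture_nest a).rotate
  · exact (tripodPicture_nest a).rotate.rotate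
  · exact tripodPicture_mid a
  · exact (tripodPicture_mid a).rotate
  · exact (tripodPicture_mid a).rotate.rotate

/-- ★ every one of the 63 readings is a tripod picture. [cite: KhristoforovSmirnov2021, §2 Lemma 4, Fig. 3 (arXiv v1 p. 4)] -/
theorem tripodPicture_of_mem_pics7 {α β γ : Fin 7} {L₀ : Finset (Fin 7 × Fin 7)} (h : (α, β, γ, L₀) ∈ pics7) : TripodPicture α β γ L₀ := by
  obtain ⟨a, r, e⟩ := mem_pics7.1 h
  have t := tripodPicture_reading a r
  rw [e] at t
  exact t

end Classes

/-! ### The class defects -/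
section Defects

variable (wt : Fin 7 → Finset (Fin 7 × Fin 7) → ℂ)

/-- **the ADJACENT-CLASS DEFECT** `A_a(wt)`: the tripod defect of the picture «neighbours to `y_a, y_{a+1}, y_{a+2}`, the others matched adjacently»,
read from the corner `a`. [cite: KhristoforovSmirnov2021, §2 Lemma 4, proof and Fig. 3 (arXiv v1 p. 4)] -/
noncomputable def defA (a : Fin 7) : ℂ := tripodDefect wt a (a + 1) (a + 2) (adjRel a)

/-- **the NESTED-CLASS DEFECT** `N_a(wt)`. [cite: KhristoforovSmirnov2021, §2 Lemma 4, proof and Fig. 3 (arXiv v1 p. 4)] -/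
noncomputable def defN (a : Fin 7) : ℂ := tripodDefect wt a (a + 1) (a + 2) (nestRel a)

/-- **the MID-CLASS DEFECT** `M_a(wt)` (triple `{a, a+1, a+4}`). [cite: KhristoforovSmirnov2021, §2 Lemma 4, proof and Fig. 3 (arXiv v1 p. 4)] -/
noncomputable def defM (a : Fin 7) : ℂ := tripodDefect wt a (a + 1) (a + 4) (midRel a)

/-- the tripod law kills the twenty-one class defects. [cite: KhristoforovSmirnov2021, §2 Lemma 4, proof and Fig. 3 (arXiv v1 p. 4)] -/
theorem classDefects_eq_zero_of_tripodLaw {wt : Fin 7 → Finset (Fin 7 × Fin 7) → ℂ} (h : TripodLaw wt) (a : Fin 7) :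
    defA wt a = 0 ∧ defN wt a = 0 ∧ defM wt a = 0 := by
  rw [tripodLaw_iff_tripodDefect] at h
  exact ⟨h _ _ _ _ (tripodPicture_adj a), h _ _ _ _ (tripodPicture_nest a), h _ _ _ _ (tripodPicture_mid a)⟩

/-- `1 + τ + τ² = 0` (the tree's `FivePoint.Rung.one_add_tau_add_sq`, kept private here for import economy). [folklore] -/
private theorem tau_sum₇ : 1 + tau + tau ^ 2 = 0 := by
  have hprim : IsPrimitiveRoot tau 3 := by
    have h := Complex.isPrimitiveRoot_exp 3 (by norm_num)
    unfold tau
    convert h using 2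
    push_cast
    ring
  have h := hprim.geom_sum_eq_zero (by norm_num : 1 < 3)
  simp only [Finset.sum_range_succ, Finset.sum_range_zero, pow_zero, pow_one, zero_add] at h
  linear_combination h

/-- `τ² = −1 − τ`. [cite: KhristoforovSmirnov2021, §2 Definition 3 (arXiv v1 p. 4: `τ = e^{2πi/3}`)] -/
theorem tau_sq_eq₇ : tau ^ 2 = -1 - tau := by linear_combination tau_sum₇

/-- `τ³ = 1` (a statement already in the tree under other names; private here, downstream files re-derive it from `tau_sq_eq₇`). [folklore] -/
private theorem tau_cube₇ : tau ^ 3 = 1 := by linear_combination (tau - 1) * tau_sum₇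

/-- `τ` is not real. [cite: KhristoforovSmirnov2021, §2 Definition 3 (arXiv v1 p. 4: `τ = e^{2πi/3}`)] -/
theorem tau_im_ne_zero₇ : tau.im ≠ 0 := by
  intro h0
  have hre := congrArg Complex.re tau_sum₇
  simp only [Complex.add_re, Complex.one_re, sq, Complex.mul_re, h0, mul_zero, sub_zero, Complex.zero_re] at hre
  nlinarith [sq_nonneg (tau.re + 1 / 2)]

/-- the defects of the nine readings from the corner `a` are `τ^{2 (r % 3)}` times the class defects: reading `0`. [cite: KhristoforovSmirnov2021, §2 Lemma 4, Fig. 3 (arXiv v1 p. 4)] -/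
theorem defectAt_reading_zero (a : Fin 7) : defectAt wt (reading a 0) = defA wt a := rfl
/-- reading `1`. [cite: KhristoforovSmirnov2021, §2 Lemma 4, Fig. 3 (arXiv v1 p. 4)] -/
theorem defectAt_reading_one (a : Fin 7) : defectAt wt (reading a 1) = tau ^ 2 * defA wt a := tripodDefect_rotate wt _ _ _ _
/-- reading `2`. [cite: KhristoforovSmirnov2021, §2 Lemma 4, Fig. 3 (arXiv v1 p. 4)] -/
theorem defectAt_reading_two (a : Fin 7) : defectAt wt (reading a 2) = tau * defA wt a := by
  show tripodDefect wt (a + 2) a (a + 1) (adjRel a) = tau * tripodDefect wt a (a + 1) (a + 2) (adjRel a)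
  rw [tripodDefect_rotate wt (a + 1) (a + 2) a, tripodDefect_rotate wt a (a + 1) (a + 2)]
  linear_combination tripodDefect wt a (a + 1) (a + 2) (adjRel a) * tau * tau_cube₇
/-- reading `3`. [cite: KhristoforovSmirnov2021, §2 Lemma 4, Fig. 3 (arXiv v1 p. 4)] -/
theorem defectAt_reading_three (a : Fin 7) : defectAt wt (reading a 3) = defN wt a := rfl
/-- reading `4`. [cite: KhristoforovSmirnov2021, §2 Lemma 4, Fig. 3 (arXiv v1 p. 4)] -/
theorem defectAt_reading_four (a : Fin 7) : defectAt wt (reading a 4) = tau ^ 2 * defN wt a := tripodDefect_rotate wt _ _ _ _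
/-- reading `5`. [cite: KhristoforovSmirnov2021, §2 Lemma 4, Fig. 3 (arXiv v1 p. 4)] -/
theorem defectAt_reading_five (a : Fin 7) : defectAt wt (reading a 5) = tau * defN wt a := by
  show tripodDefect wt (a + 2) a (a + 1) (nestRel a) = tau * tripodDefect wt a (a + 1) (a + 2) (nestRel a)
  rw [tripodDefect_rotate wt (a + 1) (a + 2) a, tripodDefect_rotate wt a (a + 1) (a + 2)]
  linear_combination tripodDefect wt a (a + 1) (a + 2) (nestRel a) * tau * tau_cube₇
/-- reading `6`. [cite: KhristoforovSmirnov2021, §2 Lemma 4, Fig. 3 (arXiv v1 p. 4)] -/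
theorem defectAt_reading_six (a : Fin 7) : defectAt wt (reading a 6) = defM wt a := rfl
/-- reading `7`. [cite: KhristoforovSmirnov2021, §2 Lemma 4, Fig. 3 (arXiv v1 p. 4)] -/
theorem defectAt_reading_seven (a : Fin 7) : defectAt wt (reading a 7) = tau ^ 2 * defM wt a := tripodDefect_rotate wt _ _ _ _
/-- reading `8`. [cite: KhristoforovSmirnov2021, §2 Lemma 4, Fig. 3 (arXiv v1 p. 4)] -/
theorem defectAt_reading_eight (a : Fin 7) : defectAt wt (reading a 8) = tau * defM wt a := by
  show tripodDefect wt (a + 4) a (a + 1) (midRel a) = tau * tripodDefect wt a (a + 1) (a + 4) (midRel a)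
  rw [tripodDefect_rotate wt (a + 1) (a + 4) a, tripodDefect_rotate wt a (a + 1) (a + 4)]
  linear_combination tripodDefect wt a (a + 1) (a + 4) (midRel a) * tau * tau_cube₇

end Defects

/-! ### Transport under the rotation of the marks -/
section Transport

/-- the defect of the transported weight (the generic-`k` bookkeeping `tripodDefect (σ·wt) = tripodDefect wt ∘ σ`).
[cite: KhristoforovSmirnov2021, §2 Lemma 4 (arXiv v1 p. 4); §1.2 (p. 2: cyclic indexing)] -/
private theorem tripodDefect_rotW₇ {nm : ℕ} (σ : Equiv.Perm (Fin nm)) (wt : Fin nm → Finset (Fin nm × Fin nm) → ℂ) (α β γ : Fin nm)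
    (L₀ : Finset (Fin nm × Fin nm)) :
    tripodDefect (rotW σ wt) α β γ L₀ = tripodDefect wt (σ α) (σ β) (σ γ) (relMap σ L₀) := by
  unfold tripodDefect rotW
  rw [relMap_withPair, relMap_withPair, relMap_withPair]

/-- the image of an explicit four-pair relation. [cite: KhristoforovSmirnov2021, §1.2 (arXiv v1 p. 2)] -/
private theorem relMap_four {nm : ℕ} (σ : Equiv.Perm (Fin nm)) (a b c d e f g h : Fin nm) :
    relMap σ ({(a, b), (c, d), (e, f), (g, h)} : Finset (Fin nm × Fin nm)) = {(σ a, σ b), (σ c, σ d), (σ e, σ f), (σ g, σ h)} := by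
  ext ⟨x, y⟩
  rw [mem_relMap]
  simp only [Finset.mem_insert, Finset.mem_singleton, Prod.mk.injEq, Equiv.symm_apply_eq]

/-- index bookkeeping in `ℤ/7`. [folklore] -/
private theorem fin7_shift : ∀ a : Fin 7, a + 1 - 1 = a - 1 + 1 ∧ a + 2 - 1 = a - 1 + 2 ∧ a + 3 - 1 = a - 1 + 3 ∧ a + 4 - 1 = a - 1 + 4 ∧
    a + 5 - 1 = a - 1 + 5 ∧ a + 6 - 1 = a - 1 + 6 := by
  decide

/-- **back-rotating the marks shifts the class index**: `A_a(rot⁻¹·wt) = A_{a−1}(wt)`.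
[cite: KhristoforovSmirnov2021, §1.2 (arXiv v1 p. 2: marked points indexed cyclically); §2 Lemma 4 (p. 4)] -/
theorem defA_rotW_symm (wt : Fin 7 → Finset (Fin 7 × Fin 7) → ℂ) (a : Fin 7) : defA (rotW (rot 7).symm wt) a = defA wt (a - 1) := by
  unfold defA adjRel
  rw [tripodDefect_rotW₇, relMap_four]
  simp only [finRotate_symm_apply]
  obtain ⟨e1, e2, e3, e4, e5, e6⟩ := fin7_shift a
  rw [e1, e2, e3, e4, e5, e6]

/-- `N_a(rot⁻¹·wt) = N_{a−1}(wt)`. [cite: KhristoforovSmirnov2021, §1.2 (arXiv v1 p. 2); §2 Lemma 4 (p. 4)] -/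
theorem defN_rotW_symm (wt : Fin 7 → Finset (Fin 7 × Fin 7) → ℂ) (a : Fin 7) : defN (rotW (rot 7).symm wt) a = defN wt (a - 1) := by
  unfold defN nestRel
  rw [tripodDefect_rotW₇, relMap_four]
  simp only [finRotate_symm_apply]
  obtain ⟨e1, e2, e3, e4, e5, e6⟩ := fin7_shift a
  rw [e1, e2, e3, e4, e5, e6]

/-- `M_a(rot⁻¹·wt) = M_{a−1}(wt)`. [cite: KhristoforovSmirnov2021, §1.2 (arXiv v1 p. 2); §2 Lemma 4 (p. 4)] -/
theorem defM_rotW_symm (wt : Fin 7 → Finset (Fin 7 × Fin 7) → ℂ) (a : Fin 7) : defM (rotW (rot 7).symm wt) a = defM wt (a - 1) := by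
  unfold defM midRel
  rw [tripodDefect_rotW₇, relMap_four]
  simp only [finRotate_symm_apply]
  obtain ⟨e1, e2, e3, e4, e5, e6⟩ := fin7_shift a
  rw [e1, e2, e3, e4, e5, e6]

open Fin.NatCast in
/-- iterating: the class index shifts by `m`. [cite: KhristoforovSmirnov2021, §1.2 (arXiv v1 p. 2); §2 Lemma 4 (p. 4)] -/
theorem classDefects_iterate (wt : Fin 7 → Finset (Fin 7 × Fin 7) → ℂ) (m : ℕ) (a : Fin 7) :
    defA ((rotW (rot 7).symm)^[m] wt) a = defA wt (a - (m : Fin 7)) ∧ defN ((rotW (rot 7).symm)^[m] wt) a = defN wt (a - (m : Fin 7)) ∧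
      defM ((rotW (rot 7).symm)^[m] wt) a = defM wt (a - (m : Fin 7)) := by
  induction m generalizing a with
  | zero => simp only [Function.iterate_zero_apply, Nat.cast_zero, sub_zero, and_self]
  | succ m ih =>
    rw [Function.iterate_succ_apply', defA_rotW_symm, defN_rotW_symm, defM_rotW_symm, (ih _).1, (ih _).2.1, (ih _).2.2, Nat.cast_succ,
      sub_sub, add_comm]
    exact ⟨rfl, rfl, rfl⟩

/-- «holomorphic on every seven-marked domain» is stable under back-rotation of the marks (apply the hypothesis to the ROTATED domain).
[cite: KhristoforovSmirnov2021, §2 Lemma 4 eq. (3) (arXiv v1 p. 4); BollobasRiordan2006, Ch. 7 §7.2.3 p. 197 (re-marking by relabelling)] -/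
theorem forall_holomorphicW_rotW_symm₇ {wt : Fin 7 → Finset (Fin 7 × Fin 7) → ℂ} (h : ∀ D : TriMarkedDomain 7, HolomorphicW D wt) :
    ∀ D : TriMarkedDomain 7, HolomorphicW D (rotW (rot 7).symm wt) := fun D =>
  (holomorphicW_rotate_iff D wt).1 (h D.rotate)

/-- … and under its iterates. [cite: KhristoforovSmirnov2021, §2 Lemma 4 eq. (3) (arXiv v1 p. 4)] -/
theorem forall_holomorphicW_iterate₇ {wt : Fin 7 → Finset (Fin 7 × Fin 7) → ℂ} (h : ∀ D : TriMarkedDomain 7, HolomorphicW D wt)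
    (m : ℕ) : ∀ D : TriMarkedDomain 7, HolomorphicW D ((rotW (rot 7).symm)^[m] wt) := by
  induction m with
  | zero => exact h
  | succ m ih => rw [Function.iterate_succ_apply']; exact forall_holomorphicW_rotW_symm₇ ih

/-- holomorphicity on the `m`-fold rotated domain is holomorphicity of the `m`-fold back-rotated weight (the tree's
`holomorphicW_rotate_iterate_iff` of `MarkedLoopNecessityFive`, restated at seven marks for import economy).
[cite: KhristoforovSmirnov2021, §2 Lemma 4 eq. (3) (arXiv v1 p. 4); BollobasRiordan2006, Ch. 7 §7.2.3 p. 197] -/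
theorem holomorphicW_rotate_iterate_iff₇ (m : ℕ) (D : TriMarkedDomain 7) (wt : Fin 7 → Finset (Fin 7 × Fin 7) → ℂ) :
    HolomorphicW (TriMarkedDomain.rotate^[m] D) wt ↔ HolomorphicW D ((rotW (rot 7).symm)^[m] wt) := by
  induction m generalizing wt with
  | zero => rfl
  | succ m ih => rw [Function.iterate_succ_apply', holomorphicW_rotate_iff, ih, Function.iterate_succ_apply]

end Transport

end Literature.Probability.Percolation.MarkedLoops
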